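import Literature.Computability.AlgebraicComplexity.OrbitCoordinateRingProofs
import Literature.Computability.AlgebraicComplexity.LMR13PLambdaDualDimension
import Literature.Computability.AlgebraicComplexity.LMR13StabilizerDimensions
import Literature.Computability.AlgebraicComplexity.DetAnnihilatorUpperBound
import Literature.Computability.AlgebraicComplexity.OrbitClosureDimension
import Literature.Computability.AlgebraicComplexity.Bur24GCTOpenProblems
import Literature.RingTheory.KrullDimension.AffineDimension
import HarnessLib

/-!
# `dim Ω_n = n⁴ − 2n² + 2` (Bürgisser 2024 §7.2): coordinate-ring bridge and the stabilizer count

Topic `Literature/Computability/AlgebraicComplexity`; theorems only, no definition, no named fact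
(cell `val-lit`, seat t13 g4, toward `Bur24_dim_detOrbitClosure_holds` — the named fact
`Bur24_dim_detOrbitClosure` of `Bur24GCTOpenProblems.lean`: for `n ≥ 1`,
`ringKrullDim ℂ[Ω_n] = n⁴ + 2 − 2n²`, `Ω_n = \overline{GL_{n²}·det_n}`). Honest framing: a classical
dimension count for an orbit closure; **`VP ≠ VNP` is NOT proved and nothing here bears on it.**

**Source.** P. Bürgisser, *Completeness classes in algebraic complexity theory*, arXiv:2406.06217,
§7.2 (`paper:arxiv-2406.06217` p0027.txt:L104–p0028.txt:L1): «Note that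
`dim Ω_n = dim GL_{n²} − dim H = n⁴ − 2n² + 2`», with `dim H = 2n² − 2` (§7.1, (7.1)).

## What is proved (part 1: the pieces independent of the orbit-dimension engine)

* `vanishingIdeal_formCoeff_orbitClosure` — for a form `f` of degree `m` (any field), the orbit and
  its closure have the same ideal in the degree-`m` coordinates:
  `I(formCoeff m '' Δ[f]) = I(GL·f) = orbitVanishingIdeal f m` (tree: `mem_orbitClosure_iff_of_subtype`).
* `ringKrullDim_orbitCoordRing_eq_affineDimension` — over `ℂ`, the Krull dimension of the tree's
  coordinate ring `OrbitCoordRing f m = ℂ[Sym^m] ⧸ I(GL·f)` IS the `affineDimension` (LMR13 files) of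
  the coefficient image `formCoeff m '' GL·f`, as an equality in `WithBot ℕ∞` (the ring is an affine
  domain — `isDomain_orbitCoordRing` — so its dimension is a natural number, Matsumura Thm 5.6 via
  `Literature.RingTheory.KrullDimension.exists_ringKrullDim_eq_and_trdeg_eq`);
  `ringKrullDim_orbitCoordRing_eq_affineDimension_orbitClosure` — the same with `Δ[f]` for `f` a form.
* `finrank_glAnn_detPoly` — **`dim 𝔤𝔩(W)_{det_n} = 2n² − 2`** (t12's `finrank_glAnn_detPoly_ge`,
  `LMR13StabilizerDimensions.lean`, and t13's `finrank_glAnn_detPoly_le`,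
  `DetAnnihilatorUpperBound.lean`): the infinitesimal form of Bürgisser's (7.1) «`dim H = 2n² − 2`».
* `finrank_glTangent_detPoly` — **`dim 𝔤𝔩(W)·det_n = n⁴ + 2 − 2n²`** for `n ≥ 1` (rank–nullity
  `finrank_glTangent_add_finrank_glAnn`, `GLAnnihilator.lean`): the count «`dim GL_{n²} − dim H`».

## What is proved (part 2: the discharge)

* **`Bur24_dim_detOrbitClosure_holds : Bur24_dim_detOrbitClosure`** — Bürgisser 2024 §7.2
  «`dim Ω_n = dim GL_{n²} − dim H = n⁴ − 2n² + 2`» for all `n ≥ 1`, as typed in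
  `Bur24GCTOpenProblems.lean` (`ringKrullDim (OrbitCoordRing det_n n) = n⁴ + 2 − 2n²`): the bridge
  above, the orbit-closure dimension theorem `dim \overline{GL·P} = dim 𝔤𝔩(W)·P`
  (`affineDimension_orbitClosure_eq_finrank_glTangent`, val-lit t11, `OrbitClosureDimension.lean` —
  generic rank of the orbit map = rank at the identity, Jacobian criterion) and
  `finrank_glTangent_detPoly`. No GIT and no orbit–stabiliser theorem for algebraic groups is used:
  `dim H` enters only through its Lie algebra `𝔤𝔩(W)_{det_n}`.

## References

* [Burgisser2024Completeness] P. Bürgisser, arXiv:2406.06217, §7.1 eq. (7.1), §7.2.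
* [MulmuleySohoni2001] K. Mulmuley, M. Sohoni, *Geometric complexity theory I*, SIAM J. Comput. 31
  (2001), §4–§5 (`Δ[f]`, `R[Δ[f]]`).
* [Matsumura1987] H. Matsumura, *Commutative Ring Theory*, CUP 1986, Thm 5.6 (`dim = trdeg`).
* [Hartshorne1977] R. Hartshorne, *Algebraic Geometry*, I §1 Prop. 1.7 (dimension of an affine set).
-/

noncomputable section

namespace Literature.Computability.AlgebraicComplexity

open MvPolynomial

/-! ### The orbit and its closure have the same ideal in degree-`m` coordinates -/

section Bridge

variable {σ : Type*} [Fintype σ] [DecidableEq σ]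

/-- **`I(formCoeff_m(Δ[f])) = I(GL·f)`** for a form `f` of degree `m` over a field `k`: a polynomial
in the degree-`m` coefficients vanishing on the orbit `GL·f` vanishes on the orbit closure `Δ[f]`
(by the very definition of `Δ[f]` as a Zariski closure, transported to the degree-`m` coordinates by
`mem_orbitClosure_iff_of_subtype`), and conversely `GL·f ⊆ Δ[f]`. Mulmuley–Sohoni 2001 §4.
[cite: MulmuleySohoni2001, §4] -/
theorem vanishingIdeal_formCoeff_orbitClosure {k : Type*} [Field k] {f : MvPolynomial σ k} {m : ℕ}
    (hf : f.IsHomogeneous m) :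
    MvPolynomial.vanishingIdeal k (formCoeff m '' orbitClosure f) = orbitVanishingIdeal f m := by
  apply le_antisymm
  · exact MvPolynomial.vanishingIdeal_anti_mono (Set.image_mono (glOrbit_subset_orbitClosure f))
  · intro F hF
    rw [MvPolynomial.mem_vanishingIdeal_iff]
    rintro _ ⟨g, hg, rfl⟩
    rw [mem_orbitClosure_iff_of_subtype (P := fun d => d ∈ degMonomials σ m)
      (fun d hd => mem_degMonomials_iff.mpr hd) hf] at hg
    obtain ⟨-, H⟩ := hg
    exact H F fun h hh => by
      obtain ⟨A, rfl⟩ := hh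
      exact mem_orbitVanishingIdeal_iff.mp hF A

/-- **`dim ℂ[Δ[f]] = dim (formCoeff_m(GL·f))` as numbers**: the Krull dimension of the coordinate
ring `OrbitCoordRing f m = ℂ[Sym^m] ⧸ I(GL·f)` (an affine domain: `isDomain_orbitCoordRing`; so a
natural number, Matsumura Thm 5.6) equals the `affineDimension` of the coefficient image of the orbit,
coerced to `WithBot ℕ∞`. Mulmuley–Sohoni 2001 §5 (`R[Δ[f]]`); Hartshorne I Prop. 1.7.
[cite: Matsumura1987, Thm 5.6] [cite: MulmuleySohoni2001, §5] -/
theorem ringKrullDim_orbitCoordRing_eq_affineDimension (f : MvPolynomial σ ℂ) (m : ℕ) :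
    ringKrullDim (OrbitCoordRing f m) =
      (affineDimension (formCoeff m '' glOrbit σ ℂ f) : WithBot ℕ∞) := by
  haveI : IsDomain (OrbitCoordRing f m) := isDomain_orbitCoordRing f m
  haveI : Algebra.FiniteType ℂ (OrbitCoordRing f m) :=
    Algebra.FiniteType.of_surjective (Ideal.Quotient.mkₐ ℂ (orbitVanishingIdeal f m))
      (Ideal.Quotient.mkₐ_surjective ℂ _)
  obtain ⟨s, hs, -⟩ :=
    Literature.RingTheory.KrullDimension.exists_ringKrullDim_eq_and_trdeg_eq ℂ (OrbitCoordRing f m)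
  change ringKrullDim (OrbitCoordRing f m) =
    ((((ringKrullDim (OrbitCoordRing f m)).unbotD 0).toNat : ℕ) : WithBot ℕ∞)
  rw [hs, ← WithBot.coe_natCast, WithBot.unbotD_coe, ENat.toNat_coe, WithBot.coe_natCast]

/-- **`dim ℂ[Δ[f]] = dim Δ[f]`** for a form `f` of degree `m`: the Krull dimension of
`OrbitCoordRing f m` equals the `affineDimension` of the degree-`m` coefficient image of the orbit
CLOSURE `Δ[f]` (same ideal as the orbit, `vanishingIdeal_formCoeff_orbitClosure`).
[cite: Matsumura1987, Thm 5.6] [cite: MulmuleySohoni2001, §5] -/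
theorem ringKrullDim_orbitCoordRing_eq_affineDimension_orbitClosure {f : MvPolynomial σ ℂ} {m : ℕ}
    (hf : f.IsHomogeneous m) :
    ringKrullDim (OrbitCoordRing f m) =
      (affineDimension (formCoeff m '' orbitClosure f) : WithBot ℕ∞) := by
  rw [ringKrullDim_orbitCoordRing_eq_affineDimension,
    PLambdaDualDim.affineDimension_eq_of_vanishingIdeal_eq (vanishingIdeal_formCoeff_orbitClosure hf)]

end Bridge

/-! ### The stabilizer count for `det_n` -/

section DetCount

/-- **`dim 𝔤𝔩(W)_{det_n} = 2n² − 2`** — the infinitesimal form of Bürgisser 2024 (7.1)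
«`dim H = 2n² − 2`» (`H` the stabilizer of `det_n` in `GL_{n²}`): lower bound by the family
`X ↦ AX + XB`, `tr A + tr B = 0` (`finrank_glAnn_detPoly_ge`, val-lit t12), upper bound by the
coefficient comparison of `DetAnnihilatorUpperBound.lean` (`finrank_glAnn_detPoly_le`).
[cite: Burgisser2024Completeness, §7.1 eq. (7.1)] -/
theorem finrank_glAnn_detPoly (n : ℕ) :
    Module.finrank ℂ (glAnn (detPoly (Fin n) ℂ)) = 2 * n ^ 2 - 2 :=
  le_antisymm (finrank_glAnn_detPoly_le n) (finrank_glAnn_detPoly_ge n)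

/-- **`dim 𝔤𝔩(W)·det_n = n⁴ + 2 − 2n²`** for `n ≥ 1` (`= n⁴ − 2n² + 2`, written truncation-free as in
the fact `Bur24_dim_detOrbitClosure`; for `n = 0`, `det_0 = 1` and the tangent space is `0`): the
tangent space of the orbit `GL_{n²}·det_n`, i.e. the count «`dim GL_{n²} − dim H`» of Bürgisser 2024
§7.2, by rank–nullity (`finrank_glTangent_add_finrank_glAnn`) and `finrank_glAnn_detPoly`. [cite: Burgisser2024Completeness, §7.2] -/
theorem finrank_glTangent_detPoly {n : ℕ} (hn : 1 ≤ n) :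
    Module.finrank ℂ (glTangent (detPoly (Fin n) ℂ)) = n ^ 4 + 2 - 2 * n ^ 2 := by
  have h := finrank_glTangent_add_finrank_glAnn (detPoly (Fin n) ℂ)
  rw [Fintype.card_prod, Fintype.card_fin, finrank_glAnn_detPoly] at h
  have h4 : (n * n) ^ 2 = n ^ 2 * n ^ 2 := by ring
  have h4' : n ^ 4 = n ^ 2 * n ^ 2 := by ring
  rw [h4] at h
  rw [h4']
  have h1 : 1 ≤ n ^ 2 := Nat.one_le_pow _ _ hn
  have h2 : 2 * n ^ 2 ≤ n ^ 2 * n ^ 2 + 2 := by nlinarith [h1]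
  omega

end DetCount

/-! ### The discharge -/

section Discharge

/-- **Bürgisser 2024, §7.2: `dim Ω_n = dim GL_{n²} − dim H = n⁴ − 2n² + 2`** for the affine cone
`Ω_n = \overline{GL_{n²}·det_n}`, `n ≥ 1` (`paper:arxiv-2406.06217` p0027.txt:L104–p0028.txt:L1) —
DISCHARGE of the named fact `Bur24_dim_detOrbitClosure` (`Bur24GCTOpenProblems.lean`): the Krull
dimension of the coordinate ring `ℂ[Ω_n] = OrbitCoordRing det_n n` is `n⁴ + 2 − 2n²`. Proof:
`dim ℂ[Ω_n] = dim Ω_n` (`ringKrullDim_orbitCoordRing_eq_affineDimension_orbitClosure`)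
`= dim 𝔤𝔩(W)·det_n` (`affineDimension_orbitClosure_eq_finrank_glTangent`, the orbit map has generic
rank equal to its rank at the identity) `= n⁴ − dim 𝔤𝔩(W)_{det_n} = n⁴ − (2n² − 2)`
(`finrank_glTangent_detPoly`: the annihilator of `det_n` is `{X ↦ AX + XB : tr A + tr B = 0}`
dimensionwise, `finrank_glAnn_detPoly`). [cite: Burgisser2024Completeness, §7.2 (dimension formula before Thm. 7.2)] -/
theorem Bur24_dim_detOrbitClosure_holds : Bur24_dim_detOrbitClosure := by
  intro n hn
  have hdet : (detPoly (Fin n) ℂ).IsHomogeneous n := by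
    simpa [Fintype.card_fin] using detPoly_isHomogeneous (n := Fin n) (k := ℂ)
  rw [ringKrullDim_orbitCoordRing_eq_affineDimension_orbitClosure hdet,
    affineDimension_orbitClosure_eq_finrank_glTangent hdet, finrank_glTangent_detPoly hn]

end Discharge

end Literature.Computability.AlgebraicComplexity

end
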